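import Mathlib.AlgebraicGeometry.EllipticCurve.Affine.Point
import Mathlib.RingTheory.Derivation.Basic
import HarnessLib

/-!
# The invariant differential of a Weierstrass cubic is additive (Kirby 2009, Lemma 3.1)

Topic `Literature/NumberTheory/Transcendental`. First support file for discharging the named fact
`Literature.NumberTheory.Transcendental.ax_schanuel_weierstrass` (`AxSchanuelWeierstrass.lean`;
J. Kirby, *The theory of the exponential differential equations of semiabelian varieties*,
Selecta Math. 15 (2009), Thm. 3.8, for `S = Eⁿ`). Everything here is PROVED.

**Kirby 2009, Lemma 3.1** ("If `ζ ∈ Ω[G]` is an invariant differential form then the map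
`G(F) → Ω(F/C)`, `x ↦ ζ(x)`, is a group homomorphism"; Kirby credits Rosenlicht 1957 and
Marker's notes) — here for `G = E` an elliptic curve in short Weierstrass form
`y² = x³ + a₄x + a₆` and `ζ = dx/(2y) = dy/(3x² + a₄)`, PAIRED WITH A DERIVATION `∂` of the field
`K` whose constants contain `a₄, a₆`: the map
`λ_∂ : E(K) → K`, `O ↦ 0`, `(x, y) ↦ ∂x/(2y)` (`WeierstrassCurve.Affine.Point`, Mathlib's
chord–tangent group law) is additive (`invDiff_add`, `invDiffHom`). At a point of order two
(`y = 0`) one has `∂x = 0` (`3x² + a₄ ≠ 0` by nonsingularity), so Lean's junk value `∂x/0 = 0` IS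
the value `∂y/(3x² + a₄) = 0` of the other chart (`deriv_eq_invDiff_mul`).

Proof: the invariant vector field dual to `ζ` is `V = 2y ∂/∂x + (3x² + a₄) ∂/∂y`; for a
derivation `∂` killing `a₄, a₆` and a point `P = (x, y) ∈ E(K)` one has
`(∂x, ∂y) = λ_∂(P)·(2y, 3x² + a₄)` (differentiate the equation). For the chord
`m(x₁ - x₂) = y₁ - y₂` through `P₁ ≠ ±P₂` and `x₃ = m² - x₁ - x₂`, `y₃ = -(m(x₃ - x₁) + y₁)`
(Mathlib's `addX`, `addY`), differentiating gives
`∂m = -λ₂(x₁ - x₂) - (λ₁ + λ₂)(x₃ - x₁)`, `∂x₃ = (λ₁ + λ₂)·2y₃`, `∂y₃ = (λ₁ + λ₂)(3x₃² + a₄)`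
(`chord_dm`, `chord_de`, `chord_df`: polynomial identities modulo the two curve equations, the
only input being the chord identity `m(y₁ + y₂) = x₁² + x₁x₂ + x₂² + a₄`), and likewise for the
tangent `2y₁m = 3x₁² + a₄` (`tangent_dm`, `tangent_de`, `tangent_df`); hence
`λ_∂(P₁ + P₂) = λ₁ + λ₂`, also when `y₃ = 0` (then `λ₁ + λ₂ = ∂y₃/(3x₃² + a₄) = 0`).
This is the coordinate form of the invariance of `ζ` (Silverman, AEC III.5.1) and is what
"`Σ_σ ζ(σP)(θ) = ζ(Σ_σ σP)(θ)`" needs in the Galois-averaging step of the elliptic analogue of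
Rosenlicht's residue argument (`AxSchanuelWeierstrassDescent.lean`).

## Contents

* `invDiff W ∂ P` — `λ_∂(P) = ∂x_P / (2y_P + a₁x_P + a₃)` (`0` at `O`), for any Weierstrass
  curve; `IsShortConst W ∂` — `a₁ = a₂ = a₃ = 0` and `∂a₄ = ∂a₆ = 0`.
* `deriv_eq_invDiff_mul` — `(∂x, ∂y) = λ·(2y, 3x² + a₄)` at a nonsingular point.
* `invDiff_add`, `invDiff_neg`, `invDiffHom : W.Point →+ K`, `invDiff_sum`.

## References

* J. Kirby, Selecta Math. (N.S.) 15 (2009), 445–486, Lemma 3.1 and §3.2.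
* J. H. Silverman, *The Arithmetic of Elliptic Curves*, III.1.5 (`ω = dx/(2y + a₁x + a₃)
  = dy/(3x² + 2a₂x + a₄ - a₁y)`) and III.5.1 (invariance).
-/

noncomputable section

namespace Literature.NumberTheory.Transcendental

namespace AxSchanuelWeierstrass

open WeierstrassCurve WeierstrassCurve.Affine

/-! ### Polynomial identities behind the invariance of `dx/(2y)` -/

section Identities

variable {K : Type*} [Field K]

/-- The chord identity: for two points of `y² = x³ + Ax + B` with `x₁ ≠ x₂` on the line of slope
`m`, `m(y₁ + y₂) = x₁² + x₁x₂ + x₂² + A`. [folklore] -/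
theorem chord {a b c d m A B : K} (hac : a ≠ c) (h₁ : b ^ 2 = a ^ 3 + A * a + B)
    (h₂ : d ^ 2 = c ^ 3 + A * c + B) (hm : m * (a - c) = b - d) :
    m * (b + d) = a ^ 2 + a * c + c ^ 2 + A := by
  have h : (m * (b + d) - (a ^ 2 + a * c + c ^ 2 + A)) * (a - c) = 0 := by
    linear_combination (b + d) * hm + h₁ - h₂
  rcases mul_eq_zero.mp h with h | h
  · exact sub_eq_zero.mp h
  · exact absurd (sub_eq_zero.mp h) hac

/-- Derivative of the chord slope along the invariant vector fields: if
`(∂xᵢ, ∂yᵢ) = λᵢ (2yᵢ, 3xᵢ² + A)` and `∂m (x₁ - x₂) + m(∂x₁ - ∂x₂) = ∂y₁ - ∂y₂`, then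
`∂m = -λ₂(x₁ - x₂) - (λ₁ + λ₂)(x₃ - x₁)` with `x₃ = m² - x₁ - x₂`. [folklore] -/
theorem chord_dm {a b c d m A B l u da db dc dd dm : K} (hac : a ≠ c)
    (h₁ : b ^ 2 = a ^ 3 + A * a + B) (h₂ : d ^ 2 = c ^ 3 + A * c + B) (hm : m * (a - c) = b - d)
    (hda : da = l * (2 * b)) (hdb : db = l * (3 * a ^ 2 + A))
    (hdc : dc = u * (2 * d)) (hdd : dd = u * (3 * c ^ 2 + A))
    (hdm : dm * (a - c) + m * (da - dc) = db - dd) :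
    dm = -u * (a - c) - (l + u) * ((m ^ 2 - a - c) - a) := by
  have hiii := chord hac h₁ h₂ hm
  have h : (dm - (-u * (a - c) - (l + u) * ((m ^ 2 - a - c) - a))) * (a - c) = 0 := by
    linear_combination hdm + l * (m * hm - hiii) + u * (hiii + m * hm) + hdb - hdd
      - m * hda + m * hdc
  rcases mul_eq_zero.mp h with h | h
  · exact sub_eq_zero.mp h
  · exact absurd (sub_eq_zero.mp h) hac

/-- `∂x₃ = (λ₁ + λ₂) · 2y₃` for the chord, where `y₃ = -(m(x₃ - x₁) + y₁)`. [folklore] -/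
theorem chord_de {a b c d m l u da dc dm : K} (hm : m * (a - c) = b - d)
    (hda : da = l * (2 * b)) (hdc : dc = u * (2 * d))
    (hdm : dm = -u * (a - c) - (l + u) * ((m ^ 2 - a - c) - a)) :
    2 * m * dm - da - dc = (l + u) * (2 * -(m * ((m ^ 2 - a - c) - a) + b)) := by
  linear_combination 2 * m * hdm - hda - hdc - 2 * u * hm

/-- `∂y₃ = (λ₁ + λ₂)(3x₃² + A)` for the chord. [folklore] -/
theorem chord_df {a b c d m A B l u da db de dm : K} (hac : a ≠ c)
    (h₁ : b ^ 2 = a ^ 3 + A * a + B) (h₂ : d ^ 2 = c ^ 3 + A * c + B) (hm : m * (a - c) = b - d)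
    (hda : da = l * (2 * b)) (hdb : db = l * (3 * a ^ 2 + A))
    (hdm : dm = -u * (a - c) - (l + u) * ((m ^ 2 - a - c) - a))
    (hde : de = (l + u) * (2 * -(m * ((m ^ 2 - a - c) - a) + b))) :
    -(dm * ((m ^ 2 - a - c) - a) + m * (de - da) + db) =
      (l + u) * (3 * (m ^ 2 - a - c) ^ 2 + A) := by
  have hiii := chord hac h₁ h₂ hm
  linear_combination (-((m ^ 2 - a - c) - a)) * hdm - m * hde + m * hda - hdb
    + (2 * l + u) * (hiii - m * hm)

/-- Derivative of the tangent slope `2y₁ m = 3x₁² + A`: `∂m = -2λ(x₃ - x₁)`, `x₃ = m² - 2x₁`.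
[folklore] -/
theorem tangent_dm [CharZero K] {a b m A l da db dm : K} (hb : b ≠ 0)
    (hm : m * (2 * b) = 3 * a ^ 2 + A) (hda : da = l * (2 * b)) (hdb : db = l * (3 * a ^ 2 + A))
    (hdm : dm * (2 * b) + m * (2 * db) = 6 * a * da) :
    dm = -(2 * l) * ((m ^ 2 - a - a) - a) := by
  have h : (dm + 2 * l * ((m ^ 2 - a - a) - a)) * (2 * b) = 0 := by
    linear_combination hdm - 2 * m * hdb + 6 * a * hda + 2 * l * m * hm
  rcases mul_eq_zero.mp h with h | h
  · linear_combination h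
  · exact absurd (mul_eq_zero.mp h) (by simp [hb])

/-- `∂x₃ = 2λ · 2y₃` for the tangent. [folklore] -/
theorem tangent_de {a b m l da dm : K} (hda : da = l * (2 * b))
    (hdm : dm = -(2 * l) * ((m ^ 2 - a - a) - a)) :
    2 * m * dm - da - da = (l + l) * (2 * -(m * ((m ^ 2 - a - a) - a) + b)) := by
  linear_combination 2 * m * hdm - 2 * hda

/-- `∂y₃ = 2λ (3x₃² + A)` for the tangent. [folklore] -/
theorem tangent_df {a b m A l da db de dm : K} (hm : m * (2 * b) = 3 * a ^ 2 + A)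
    (hda : da = l * (2 * b)) (hdb : db = l * (3 * a ^ 2 + A))
    (hdm : dm = -(2 * l) * ((m ^ 2 - a - a) - a))
    (hde : de = (l + l) * (2 * -(m * ((m ^ 2 - a - a) - a) + b))) :
    -(dm * ((m ^ 2 - a - a) - a) + m * (de - da) + db) =
      (l + l) * (3 * (m ^ 2 - a - a) ^ 2 + A) := by
  linear_combination (-((m ^ 2 - a - a) - a)) * hdm - m * hde + m * hda - hdb + 3 * l * hm

end Identities

/-! ### The invariant differential paired with a derivation -/

section InvDiff

variable {R K : Type*} [CommRing R] [Field K] [Algebra R K]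

/-- `λ_∂(P) = ζ(P)(∂)`: the invariant differential `ζ = dx/(2y + a₁x + a₃)` of a Weierstrass
curve, evaluated at a point `P` and paired with a derivation `∂` of the field: `0` at `O` and
`∂x/(2y + a₁x + a₃)` at an affine point `(x, y)` (Lean's `·/0 = 0` at points of order two, which
is the correct value when the coefficients are constants, see `deriv_eq_invDiff_mul`).
[cite: Kirby2009, Lemma 3.1 and §3.2] -/
def invDiff (W : Affine K) (D : Derivation R K K) : W.Point → K
  | .zero => 0
  | .some x y _ => D x / (2 * y + W.a₁ * x + W.a₃)

variable {W : Affine K} {D : Derivation R K K}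

/-- `λ_∂(O) = 0`. [folklore] -/
@[simp] theorem invDiff_zero : invDiff W D 0 = 0 := rfl

/-- `λ_∂(x, y) = ∂x/(2y + a₁x + a₃)`. [folklore] -/
@[simp] theorem invDiff_some {x y : K} (h : W.Nonsingular x y) :
    invDiff W D (.some x y h) = D x / (2 * y + W.a₁ * x + W.a₃) := rfl

variable (W D) in
/-- The hypotheses under which `λ_∂` is additive in this file: `W` is in short Weierstrass form
`y² = x³ + a₄x + a₆` and its coefficients are constants of `∂`. [folklore] -/
structure IsShortConst : Prop where
  a₁ : W.a₁ = 0
  a₂ : W.a₂ = 0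
  a₃ : W.a₃ = 0
  a₄ : D W.a₄ = 0
  a₆ : D W.a₆ = 0

variable (hW : IsShortConst W D)
include hW

/-- The short Weierstrass equation `y² = x³ + a₄x + a₆`. [folklore] -/
theorem IsShortConst.equation {x y : K} (h : W.Equation x y) :
    y ^ 2 = x ^ 3 + W.a₄ * x + W.a₆ := by
  rw [equation_iff, hW.a₁, hW.a₂, hW.a₃] at h
  linear_combination h

/-- `negY x y = -y` in short Weierstrass form. [folklore] -/
theorem IsShortConst.negY (x y : K) : W.negY x y = -y := by
  rw [WeierstrassCurve.Affine.negY, hW.a₁, hW.a₃]; ring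

/-- The denominator `2y + a₁x + a₃ = 2y` in short Weierstrass form. [folklore] -/
theorem IsShortConst.den (x y : K) : 2 * y + W.a₁ * x + W.a₃ = 2 * y := by
  rw [hW.a₁, hW.a₃]; ring

/-- At a point of order two (`y = 0`) of a nonsingular short Weierstrass cubic,
`3x² + a₄ ≠ 0`. [folklore] -/
theorem IsShortConst.three_mul_sq_add_ne_zero {x y : K} (h : W.Nonsingular x y) (hy : y = 0) :
    3 * x ^ 2 + W.a₄ ≠ 0 := by
  have h2 := (W.nonsingular_iff' x y).mp h
  rw [hW.a₁, hW.a₂, hW.a₃, hy] at h2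
  rcases h2.2 with h2 | h2
  · intro h0; apply h2; linear_combination -h0
  · exact absurd (by ring) h2

omit hW in
/-- A derivation kills the numeral `2`. [folklore] -/
theorem derivation_two : D (2 : K) = 0 := by simpa using D.map_natCast 2

omit hW in
/-- A derivation kills the numeral `3`. [folklore] -/
theorem derivation_three : D (3 : K) = 0 := by simpa using D.map_natCast 3

/-- **The tangent direction.** For a derivation `∂` killing `a₄, a₆` and a nonsingular point
`(x, y)` of `y² = x³ + a₄x + a₆`: `(∂x, ∂y) = λ · (2y, 3x² + a₄)` with `λ = λ_∂(x, y) = ∂x/(2y)`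
(at `y = 0`: `∂x = ∂y = 0 = λ`). [cite: Kirby2009, §3.2 (logarithmic derivative via invariant forms)] -/
theorem deriv_eq_invDiff_mul [CharZero K] {x y : K} (h : W.Nonsingular x y) :
    D x = D x / (2 * y) * (2 * y) ∧ D y = D x / (2 * y) * (3 * x ^ 2 + W.a₄) := by
  have heq := hW.equation h.1
  have hD : 2 * y * D y = (3 * x ^ 2 + W.a₄) * D x := by
    have := congrArg D heq
    simp only [map_add, Derivation.leibniz, Derivation.leibniz_pow, hW.a₄, hW.a₆,
      smul_eq_mul, nsmul_eq_mul, mul_zero, add_zero] at this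
    push_cast at this
    linear_combination this
  by_cases hy : y = 0
  · have h3 := hW.three_mul_sq_add_ne_zero h hy
    have hx : D x = 0 := by
      rw [hy, mul_zero, zero_mul] at hD
      exact (mul_eq_zero.mp hD.symm).resolve_left h3
    subst hy
    simp [hx]
  · have h2y : 2 * y ≠ 0 := mul_ne_zero two_ne_zero hy
    constructor
    · rw [div_mul_cancel₀ _ h2y]
    · field_simp
      linear_combination hD

/-- From `∂x₃ = s · 2y₃` and `∂y₃ = s (3x₃² + a₄)` at a nonsingular point: `λ_∂(x₃, y₃) = s`
(if `y₃ = 0` then `3x₃² + a₄ ≠ 0` and `∂y₃ = 0`). [folklore] -/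
theorem invDiff_eq_of_deriv [CharZero K] {e f s : K} (h : W.Nonsingular e f)
    (hde : D e = s * (2 * f)) (hdf : D f = s * (3 * e ^ 2 + W.a₄)) :
    D e / (2 * f + W.a₁ * e + W.a₃) = s := by
  rw [hW.den]
  by_cases hf : f = 0
  · have h3 := hW.three_mul_sq_add_ne_zero h hf
    subst hf
    rw [map_zero] at hdf
    have hs : s = 0 := (mul_eq_zero.mp hdf.symm).resolve_right h3
    simp [hs]
  · rw [hde, mul_div_assoc, div_self (mul_ne_zero two_ne_zero hf), mul_one]

/-- **Kirby 2009, Lemma 3.1 for `E : y² = x³ + a₄x + a₆` (Rosenlicht 1957): the invariant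
differential is additive**, `λ_∂(P + Q) = λ_∂(P) + λ_∂(Q)` for Mathlib's chord–tangent addition,
when `∂a₄ = ∂a₆ = 0`. [cite: Kirby2009, Lemma 3.1] -/
theorem invDiff_add [DecidableEq K] [CharZero K] (P Q : W.Point) :
    invDiff W D (P + Q) = invDiff W D P + invDiff W D Q := by
  rcases P with _ | ⟨x₁, y₁, h₁⟩ <;> rcases Q with _ | ⟨x₂, y₂, h₂⟩
  · change invDiff W D (0 + 0) = invDiff W D 0 + invDiff W D 0
    rw [add_zero, invDiff_zero, add_zero]
  · change invDiff W D (0 + _) = invDiff W D 0 + _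
    rw [zero_add, invDiff_zero, zero_add]
  · change invDiff W D (_ + 0) = _ + invDiff W D 0
    rw [add_zero, invDiff_zero, add_zero]
  -- two affine points
  obtain ⟨hdx₁, hdy₁⟩ := deriv_eq_invDiff_mul hW h₁
  obtain ⟨hdx₂, hdy₂⟩ := deriv_eq_invDiff_mul hW h₂
  set l := D x₁ / (2 * y₁) with hl
  set u := D x₂ / (2 * y₂) with hu
  have he₁ := hW.equation h₁.1
  have he₂ := hW.equation h₂.1
  by_cases hxy : x₁ = x₂ ∧ y₁ = W.negY x₂ y₂
  · -- `P + Q = O`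
    obtain ⟨rfl, hy⟩ := hxy
    rw [Point.add_of_Y_eq rfl hy, invDiff_zero, invDiff_some, invDiff_some, hW.den, hW.den, hy,
      hW.negY, mul_neg, div_neg, ← hu, neg_add_cancel]
  rw [Point.add_some hxy, invDiff_some, invDiff_some, invDiff_some, hW.den x₁, hW.den x₂, ← hl,
    ← hu]
  set m := W.slope x₁ x₂ y₁ y₂ with hm_def
  have haddX : W.addX x₁ x₂ m = m ^ 2 - x₁ - x₂ := by
    rw [WeierstrassCurve.Affine.addX, hW.a₁, hW.a₂]; ring
  have haddY : W.addY x₁ x₂ y₁ m = -(m * ((m ^ 2 - x₁ - x₂) - x₁) + y₁) := by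
    rw [WeierstrassCurve.Affine.addY, hW.negY, WeierstrassCurve.Affine.negAddY, haddX]
  have hns : W.Nonsingular (W.addX x₁ x₂ m) (W.addY x₁ x₂ y₁ m) := nonsingular_add h₁ h₂ hxy
  apply invDiff_eq_of_deriv hW hns
  -- it remains to compute `∂x₃` and `∂y₃`
  all_goals rw [haddY, haddX]
  all_goals by_cases hx : x₁ = x₂
  · -- tangent, `∂x₃`
    subst hx
    have hy' : y₁ ≠ W.negY x₁ y₂ := fun h => hxy ⟨rfl, h⟩
    have hy12 : y₁ = y₂ := Y_eq_of_Y_ne h₁.1 h₂.1 rfl hy'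
    subst hy12
    have hy0 : y₁ ≠ 0 := fun h0 => hy' (by rw [hW.negY, h0, neg_zero])
    have hm : m * (2 * y₁) = 3 * x₁ ^ 2 + W.a₄ := by
      rw [hm_def, slope_of_Y_ne rfl hy', hW.negY, hW.a₁, hW.a₂, sub_neg_eq_add]
      field_simp
      ring
    have hdm : D m * (2 * y₁) + m * (2 * D y₁) = 6 * x₁ * D x₁ := by
      have := congrArg D hm
      simp only [map_add, Derivation.leibniz, Derivation.leibniz_pow, hW.a₄, smul_eq_mul,
        nsmul_eq_mul, add_zero, derivation_two, derivation_three, mul_zero] at this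
      push_cast at this
      linear_combination this
    have hdm' := tangent_dm hy0 hm hdx₁ hdy₁ hdm
    have : D (m ^ 2 - x₁ - x₁) = 2 * m * D m - D x₁ - D x₁ := by
      simp only [map_sub, Derivation.leibniz_pow, smul_eq_mul, nsmul_eq_mul]; push_cast; ring
    have hul : u = l := by rw [hu, hl]
    rw [this, hul]
    exact tangent_de hdx₁ hdm'
  · -- chord, `∂x₃`
    have hm : m * (x₁ - x₂) = y₁ - y₂ := by
      rw [hm_def, slope_of_X_ne hx, div_mul_cancel₀ _ (sub_ne_zero.mpr hx)]
    have hdm : D m * (x₁ - x₂) + m * (D x₁ - D x₂) = D y₁ - D y₂ := by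
      have := congrArg D hm
      simp only [map_sub, Derivation.leibniz, smul_eq_mul] at this
      linear_combination this
    have hdm' := chord_dm hx he₁ he₂ hm hdx₁ hdy₁ hdx₂ hdy₂ hdm
    have : D (m ^ 2 - x₁ - x₂) = 2 * m * D m - D x₁ - D x₂ := by
      simp only [map_sub, Derivation.leibniz_pow, smul_eq_mul, nsmul_eq_mul]; push_cast; ring
    rw [this]
    exact chord_de hm hdx₁ hdx₂ hdm'
  · -- tangent, `∂y₃`
    subst hx
    have hy' : y₁ ≠ W.negY x₁ y₂ := fun h => hxy ⟨rfl, h⟩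
    have hy12 : y₁ = y₂ := Y_eq_of_Y_ne h₁.1 h₂.1 rfl hy'
    subst hy12
    have hy0 : y₁ ≠ 0 := fun h0 => hy' (by rw [hW.negY, h0, neg_zero])
    have hm : m * (2 * y₁) = 3 * x₁ ^ 2 + W.a₄ := by
      rw [hm_def, slope_of_Y_ne rfl hy', hW.negY, hW.a₁, hW.a₂, sub_neg_eq_add]
      field_simp
      ring
    have hdm : D m * (2 * y₁) + m * (2 * D y₁) = 6 * x₁ * D x₁ := by
      have := congrArg D hm
      simp only [map_add, Derivation.leibniz, Derivation.leibniz_pow, hW.a₄, smul_eq_mul,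
        nsmul_eq_mul, add_zero, derivation_two, derivation_three, mul_zero] at this
      push_cast at this
      linear_combination this
    have hdm' := tangent_dm hy0 hm hdx₁ hdy₁ hdm
    have hde : D (m ^ 2 - x₁ - x₁) = 2 * m * D m - D x₁ - D x₁ := by
      simp only [map_sub, Derivation.leibniz_pow, smul_eq_mul, nsmul_eq_mul]; push_cast; ring
    have hde' := tangent_de hdx₁ hdm'
    rw [← hde] at hde'
    have : D (-(m * ((m ^ 2 - x₁ - x₁) - x₁) + y₁)) =
        -(D m * ((m ^ 2 - x₁ - x₁) - x₁) + m * (D (m ^ 2 - x₁ - x₁) - D x₁) + D y₁) := by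
      simp only [map_neg, map_add, map_sub, Derivation.leibniz, smul_eq_mul]; ring
    have hul : u = l := by rw [hu, hl]
    rw [this, hul]
    exact tangent_df hm hdx₁ hdy₁ hdm' hde'
  · -- chord, `∂y₃`
    have hm : m * (x₁ - x₂) = y₁ - y₂ := by
      rw [hm_def, slope_of_X_ne hx, div_mul_cancel₀ _ (sub_ne_zero.mpr hx)]
    have hdm : D m * (x₁ - x₂) + m * (D x₁ - D x₂) = D y₁ - D y₂ := by
      have := congrArg D hm
      simp only [map_sub, Derivation.leibniz, smul_eq_mul] at this
      linear_combination this
    have hdm' := chord_dm hx he₁ he₂ hm hdx₁ hdy₁ hdx₂ hdy₂ hdm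
    have hde : D (m ^ 2 - x₁ - x₂) = 2 * m * D m - D x₁ - D x₂ := by
      simp only [map_sub, Derivation.leibniz_pow, smul_eq_mul, nsmul_eq_mul]; push_cast; ring
    have hde' := chord_de hm hdx₁ hdx₂ hdm'
    rw [← hde] at hde'
    have : D (-(m * ((m ^ 2 - x₁ - x₂) - x₁) + y₁)) =
        -(D m * ((m ^ 2 - x₁ - x₂) - x₁) + m * (D (m ^ 2 - x₁ - x₂) - D x₁) + D y₁) := by
      simp only [map_neg, map_add, map_sub, Derivation.leibniz, smul_eq_mul]; ring
    rw [this]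
    exact chord_df hx he₁ he₂ hm hdx₁ hdy₁ hdm' hde'

/-- `λ_∂(-P) = -λ_∂(P)`. [folklore] -/
theorem invDiff_neg (P : W.Point) : invDiff W D (-P) = -invDiff W D P := by
  rcases P with _ | ⟨x, y, h⟩
  · change invDiff W D (-0) = -invDiff W D 0
    rw [Point.neg_zero, invDiff_zero, neg_zero]
  · rw [Point.neg_some, invDiff_some, invDiff_some, hW.den, hW.den, hW.negY, mul_neg, div_neg]

omit hW in
variable (W D) in
/-- **The homomorphism `λ_∂ : E(K) → (K, +)`** (Kirby 2009, Lemma 3.1, for a short Weierstrass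
curve with `∂`-constant coefficients). [cite: Kirby2009, Lemma 3.1] -/
def invDiffHom [DecidableEq K] [CharZero K] (hW : IsShortConst W D) : W.Point →+ K where
  toFun := invDiff W D
  map_zero' := invDiff_zero
  map_add' := invDiff_add hW

/-- Unfolding `invDiffHom`. [folklore] -/
@[simp] theorem invDiffHom_apply [DecidableEq K] [CharZero K] (P : W.Point) :
    invDiffHom W D hW P = invDiff W D P := rfl

/-- `λ_∂(Σ Pᵢ) = Σ λ_∂(Pᵢ)`. [cite: Kirby2009, Lemma 3.1] -/
theorem invDiff_sum [DecidableEq K] [CharZero K] {ι : Type*} (s : Finset ι) (P : ι → W.Point) :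
    invDiff W D (∑ i ∈ s, P i) = ∑ i ∈ s, invDiff W D (P i) :=
  map_sum (invDiffHom W D hW) P s

end InvDiff

end AxSchanuelWeierstrass

end Literature.NumberTheory.Transcendental
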